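import Summits.HodgeConjecture.HodgeConjecture.Theorems.R90S6HyperbolicHeckeFL              -- ★ (B2d) FILE 1 p864363 (this seat): the HEAD `stableOrbitalIntegralRel_eq_finsum_finExplicitDelta_of_levi_of_values` over value binders
import Summits.HodgeConjecture.HodgeConjecture.Theorems.R90S6ConstantTermTransportValue     -- ★ (B2a) FILE 2 p864239 (R90-C14-p01): the `G`-side value `classOrbitalIntegral_coeff_toVector_frame_eq`
import Summits.HodgeConjecture.HodgeConjecture.Theorems.R90S6ConstantTermTransportValueH    -- ★ (B2a) FILE 3 p864332 (R90-C14-p01): the `H`-side value `classOrbitalIntegral_prod_coeff_toVector_frame_eq_two`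
import Summits.HodgeConjecture.HodgeConjecture.Theorems.R90S6SatakeCoeffGraphPartner       -- ★ B3 p864105 (R90-C14-p04): `coeff_satakeTransform_satakeGraphPartner`
import Summits.HodgeConjecture.HodgeConjecture.Theorems.R90S6SatakeGraphPartnerHom        -- ★ W4 (R90-C14-p03): `eq_satakeGraphPartner_of_graph`, `satakeGraphPartnerAlgHom_apply`
import Literature.NumberTheory.Automorphic.HyperspecialUnitaryIwasawaExponents              -- ★ `v_apply_self_eq_exp_neg_iwasawaExp`
import Literature.NumberTheory.Automorphic.UnitOrbitalIntegralFixedPointsPair               -- ★ `cmLocalIntegralLevel_one_eq_top_of_smul_eq` (`U(Φ₁)(L⁺_v)` is its own integral level at a non-split place)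
import HarnessLib

/-!
# R90 · S6 «Ch. 14.1–14.5 stable TF» — card F5 (B2d) CLOSED: THE HYPERBOLIC (LEVI-STRATUM) CLAUSE OF THE HECKE-ALGEBRA FUNDAMENTAL LEMMA AT `Δ‴_v`
# FOR THE FRAMED HECKE TEST FUNCTIONS `(T₂[K₀] ∘ eH ∘ fst, T₃[K₀] ∘ eG)` (`Theorems/R90S6HyperbolicHeckeFLClosed.lean`)

Cell `hodgecm-mathlib`, crux H413 (`stmt-HodgeConjecture-24833`), route of record `HCCMUnconditional`; programme R90-TF (brief `director/R90-BRIEF.v2.md`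
1f40d54518340a35), section S6 (base `R90-C14`, dealer R90-C14-plan (g2)), seat R90-C14-p09 (g2); the CLOSED SEQUEL of card F5 (B2d) announced with the (B2d) heads
(R90 bus 2026-09-05T01:34:18Z, dealer «=» 01:34:52Z; currency ruling 01:35:34Z «p01's MAIN stays in its tokens, p09 bridges in `…Closed`»; 01:43:05Z «the H-side value is
p01's FILE 3 — import it»); DAG row E1.3.6.2.  Lane `--kind proof --supports stmt-HodgeConjecture-24833 --as helper`; THEOREMS ONLY (no definition, no instance, no notation,
no named fact, no kit, no `sorry`; DEFAULT heartbeats); imports = ★ (B2d) FILE 1 `R90S6HyperbolicHeckeFL` (p864363) + ★ (B2a) `R90S6ConstantTermTransportValue` (p864239) ∕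
`R90S6ConstantTermTransportValueH` (p864332) + ★ B3 `R90S6SatakeCoeffGraphPartner` (p864105) + ★ W4 `R90S6SatakeGraphPartnerHom` + ★ `HyperspecialUnitaryIwasawaExponents` + ★
`UnitOrbitalIntegralFixedPointsPair` + HarnessLib (Theorems → Theorems ∕ Literature; never `Lines/`).

## THE PRINT
[Rogawski1990, §4.9 Prop. 4.9.1 (b) p. 55]: for `f ∈ ℋ_G`, `ξ̂_H(f)` is a transfer of `f`; on the diagonal torus this is (4.9.2) «`Φ(γ, f) = |D(γ)|⁻¹ f^{(B)}(γ)`» on both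
groups, Cartier's `f^{(B)} =` Satake coefficient ([CartierCorvallis1979, §IV (4.2)]), `ξ̂_H(f)^∧(z) = f^∧(−z)`, and the transfer factor `Δ_{G∕H} = τ D_{G∕H}`; Lemma 4.9.2:
«on `M` the stable class and the `κ`-class are single conjugacy classes».

## WHAT IS PROVED (namespace `Summit.HodgeConjecture.HodgeConjecture.R90.S6`)
* §A **`coeff_satakeTransform_of_satakeGraph`** — for ANY pair `(φ, φ^H)` in Satake-graph position (`λ^{(2)}_{(z,1)}(φ^H) = λ^{(3)}_{(−z,1,1)}(φ)` for all `z ∈ ℂˣ`, the S6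
  socket's `SatakeGraph` unfolded) and every `k ∈ ℤ`: `(𝒮 φ^H)_{ℓ′_k} = (−1)^k (𝒮 φ)_{ℓ_k}` (`φ^H = ξ̂_H φ` by ★ `eq_satakeGraphPartner_of_graph`, then ★ B3).
* §B **`iwasawaExp_eq_lineThree_of_diagonal`**, **`iwasawaExp_eq_lineTwo_of_diagonal`** — a DIAGONAL element of `U(σ, J₀)(K)` with diagonal valuations `(exp(−m), 1, exp m)`
  resp. `(exp(−m), exp m)` has Iwasawa exponent `ℓ³_m = (m, 0, −m)` resp. `ℓ²_m = (m, −m)` (★ `v_apply_self_eq_exp_neg_iwasawaExp`).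
* §B′ `toReal_measure_mul_coe_smul_eq` — `(ν K · J).toReal • X = J · X` at `ν K = 1` (the scalar dress of the ★ canonical values, applied through `Eq.trans`).
* §C **`stableOrbitalIntegralRel_coeff_toVector_eq_finsum_finExplicitDelta_of_levi_of_frames`** (THE CLOSED CLAUSE) — at a non-split (`c • w = w`) unramified place, `H′` of good
  reduction at `w`, `μ` unramified at `w` under the μ-guard, Rogawski's `Δ‴_v`; in the frame of the two ★ (B2a) values VERBATIM (the stub frame `e = cmDatumLocalCongr L v T₀ ha₀ hT₀`
  of `G′_v`, CANONICAL `mG` (for `IsRegularElt`, Haar `νG`) and `mH` (for `IsLocalGRegular`, Haar `νH`), the levels `K = K₃`, `K₂` with finite Iwasawa pieces `κ, μ_N, κ₂, μ_{N₂}`,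
  transports `eG : G′_v ≃ₜ* U(J₀,3)(L_w)`, `eH : U(Φ₂)(L⁺_v) ≃ₜ* U(J₀,2)(L_w)` with the N-LAWS ∕ K-LAWS of (B2a) as binders, an unramified datum `hdw` at `w`), for Hecke operators
  `φ`, `φ^H` in Satake-graph position (`hgraph`), every `γ_H = (diag(d′₀, d′₁), u) ∈ H_v` on the Levi stratum, `G`-regular, with `ord_w d′₀ = m` (`hm`), under the unit
  normalisations `νG(e K₃) = 1` (`hνG1`), `νH(K_H) = 1` (`hνH1`) and the TORUS ENTRY LAWS `hEt`, `hEHt` (the framed torus elements are the diagonal matrices of the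
  `w`-components — what the one-place model ★ `localNonsplitEquiv` gives, ★ `coe_coe_localNonsplitEquiv_apply`):
  `Φ^st(γ_H, T₂[K₀] ∘ eH ∘ fst) = ∑ᶠ c, Δ‴_v(γ_H, out c) · Φ(c, T₃[K₀] ∘ eG)` — the clause of ★ `isLocalDeltaTransfer_iff` at `γ_H` for the socket's test functions
  (`heckeToFun K₀ T g = (toVector K₀ T).coeff ↑g` by `rfl`, `Cruxes/H413/Lines/R90_S6_FloorE1D.lean` :219).  PROOF = ★ FILE 1 HEAD at the norm pair `γ₀ = e(ι_v γ_H)` (★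
  `isLocalNormPair_cmDatumLocalCongr_endoEmbLocal`) with `hΦG` ≔ ★ (B2a) `classOrbitalIntegral_coeff_toVector_frame_eq` (at `t := ⟨ι_v γ_H, _⟩`, `d := ![d′₀, u, d′₁]`, the card's
  `ha hb` accepted definitionally in the `(d 0)⁻¹ d 1 ∕ (d 0)⁻¹ d 2` slots), `hΦH` ≔ ★ (B2a) `classOrbitalIntegral_prod_coeff_toVector_frame_eq_two` (at `⟨γH.1, ⟨d′, hd′⟩⟩`, `u := γH.2`;
  `hreg₂` from the Levi units, `hPH` = ★ `isLocalGRegular_out_mk`, `hK₁` = ★ `cmLocalIntegralLevel_one_eq_top_of_smul_eq`), both dressed by §B′ ∘ ★ `twistModule_cmLocal_eq` ∕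
  ★ `twistModule_cmLocal_two_eq` (`J ↦ ‖·‖`) ∘ §B (`a = ℓ_m`) through `Eq.trans`∕`congrArg` (a keyed `rw` inside the instance-laden value tokens does not terminate — recorded for
  other consumers), and `hS` ≔ §A at `k = m`.
WHAT REMAINS FOR THE E1.3.6 ASSEMBLER (Lines level, not this file): instantiate the frames at the one-place model (the BINDER PAIR `(eA) (heA : ∀ g, ↑(eA g) = ↑(localNonsplitEquiv … g))`
of ★ `F0P3cStCharTSStLevelsTransport` + p01's level-preserving `T₀`), which discharges `hN hEK hN₂ hEK₂` (★ `comap_localNonsplitEquiv_unipotentU`, ★ `mem_localIntegralLevel_iff_of_smul_eq`),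
`hEt hEHt` (★ `coe_coe_localNonsplitEquiv_apply`) and `hνG1` (level preservation + `νG(K′) = 1`); move to arbitrary socket frames by ★ (A.3)∕(A.6); and reduce an off-stratum
`G`-regular `γ_H` to the stratum by conjugation inside `H_v` (both sides are class functions).
HONEST LABEL: helper theorem, count-neutral until E1.3.6.2 closes; proves no printed global statement by itself, discharges no citation.  HC_CM is proved only modulo the 7
printed citations (2 remaining named inputs: hLiu418 = stmt-HodgeConjecture-24832, h413 = stmt-HodgeConjecture-24833) until rung 0 closes; REL ≠ ★ ≠ BUILT.

Dedup: `rg` of the five new names over `lean/` — no hit (2026-09-05T02:20Z); every cited organ is ★ and used BY NAME.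

## References
* [Rogawski1990] J. D. Rogawski, *Automorphic Representations of Unitary Groups in Three Variables*, Ann. of Math. Stud. 123 (1990): §4.9 Prop. 4.9.1 (b), (4.9.2),
  Lemma 4.9.2 pp. 54–56; §4.3 (4.3.1) p. 43; §3.5 Prop. 3.5.2 pp. 25–26.
* [CartierCorvallis1979] P. Cartier, *Representations of 𝔭-adic groups: a survey*, PSPM 33.1 (1979): §IV (4.2) p. 146, Thm. 4.1, Cor. 4.2.
* [BruhatTits1972] F. Bruhat, J. Tits, *Groupes réductifs sur un corps local I*, Publ. Math. IHÉS 41 (1972): (4.4.3).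
-/

set_option autoImplicit false
-- the mandated namespace repeats the single-problem summit's segment (`HodgeConjecture.HodgeConjecture`)
set_option linter.dupNamespace false

noncomputable section

open MeasureTheory Measure Set NumberField IsDedekindDomain Matrix
open Literature.NumberTheory.Automorphic Literature.NumberTheory.Automorphic.UnitaryGroup
open Literature.NumberTheory.Automorphic.HermitianLattice Literature.NumberTheory.Automorphic.HermitianLattice.UnramifiedLocalConjDatum
open Literature.NumberTheory.GaloisRepresentations
open Literature.NumberTheory.Rogawski1990
open scoped NNReal ENNReal Matrix MatrixGroups Valued WithZero

namespace Summit.HodgeConjecture.HodgeConjecture.R90.S6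

/-! ## §A The Satake-coefficient sign transport for a Satake-graph pair -/

section Graph

variable {F E : Type} [Field F] [NumberField F] [Field E] [NumberField E] [Algebra F E] [Algebra.IsQuadraticExtension F E]
  (c : E ≃ₐ[F] E) (hc1 : c ≠ 1) (v : HeightOneSpectrum (𝓞 F)) (w : PlacesOver E v) (hw : c • w.1 = w.1)
  (hv : Algebra.IsUnramifiedIn (𝓞 E) v.asIdeal)

/-- **`S₂ = (−1)^k S₃` for ANY Satake-graph pair**: if `λ^{(2)}_{(z,1)}(φ^H) = λ^{(3)}_{(−z,1,1)}(φ)` for all `z ∈ ℂˣ` (the socket's `SatakeGraph φ φ^H`, unfolded), then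
`(𝒮 φ^H)_{ℓ′_k} = (−1)^k (𝒮 φ)_{ℓ_k}` for every `k ∈ ℤ` — `φ^H = ξ̂_H φ` by ★ `eq_satakeGraphPartner_of_graph`, then ★ B3. [cite: Rogawski1990, §4.9 p. 55]
[cite: CartierCorvallis1979, §IV Cor. 4.2] -/
theorem coeff_satakeTransform_of_satakeGraph {ϖ : w.1.adicCompletion E}
    (hd : UnramifiedLocalConjDatum (galAdicCompletionMap (L := E) c hw) ϖ)
    (φ : heckeAlgebra ℂ ↥(unitaryGroupOfForm (galAdicCompletionMap (L := E) c hw) ((StdForm.antidiagonal 3).over (w.1.adicCompletion E)))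
      (unitaryInt (galAdicCompletionMap (L := E) c hw) ((StdForm.antidiagonal 3).over (w.1.adicCompletion E))))
    (φH : heckeAlgebra ℂ ↥(unitaryGroupOfForm (galAdicCompletionMap (L := E) c hw) ((StdForm.antidiagonal 2).over (w.1.adicCompletion E)))
      (unitaryInt (galAdicCompletionMap (L := E) c hw) ((StdForm.antidiagonal 2).over (w.1.adicCompletion E))))
    (hgraph : ∀ z : ℂˣ, unitaryHeckeEigencharacterAdic c hc1 v w hw hv ![z, 1] φH = unitaryHeckeEigencharacterAdic c hc1 v w hw hv ![-z, 1, 1] φ)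
    (k : ℤ) :
    (hd.satakeTransform φH).coeff (fun i : Fin 2 => k * (1 - 2 * ((i : ℕ) : ℤ))) =
      (-1 : ℂ) ^ k * (hd.satakeTransform φ).coeff (fun i : Fin 3 => k * (1 - ((i : ℕ) : ℤ))) := by
  rw [eq_satakeGraphPartner_of_graph c hc1 v w hw hv φ φH hgraph, ← satakeGraphPartnerAlgHom_apply]
  exact coeff_satakeTransform_satakeGraphPartner c hc1 v w hw hv hd φ k

end Graph

/-! ## §B The Iwasawa exponents of a diagonal element of `U(σ, J₀)(K)` on the lines `ℓ³_m`, `ℓ²_m` -/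

section Diagonal

variable {K : Type*} [Field K] [Valued K ℤᵐ⁰] {σ : K →+* K} {ϖ : K}

/-- **`a(diag(y₀, y₁, y₂)) = ℓ³_m = (m, 0, −m)`** for a diagonal element of `U(σ, J₀)(K)` (`N = 3`) with `v(y₀) = exp(−m)`, `v(y₁) = 1`, `v(y₂) = exp m` (★
`v_apply_self_eq_exp_neg_iwasawaExp`: the exponents of an upper triangular element are the valuations of its diagonal). [cite: BruhatTits1972, (4.4.3)]
[cite: CartierCorvallis1979, §IV (4.2)] -/
theorem iwasawaExp_eq_lineThree_of_diagonal (hd : UnramifiedLocalConjDatum σ ϖ)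
    {b : unitaryGroupOfForm σ ((StdForm.antidiagonal 3).over K)} {y : Fin 3 → K}
    (hb : ((b : GL (Fin 3) K) : Matrix (Fin 3) (Fin 3) K) = Matrix.diagonal y) {m : ℤ}
    (h0 : Valued.v (y 0) = WithZero.exp (-m)) (h1 : Valued.v (y 1) = 1) (h2 : Valued.v (y 2) = WithZero.exp m) :
    hd.iwasawaExp b = fun i : Fin 3 => m * (1 - ((i : ℕ) : ℤ)) := by
  have htri : ((b : GL (Fin 3) K) : Matrix (Fin 3) (Fin 3) K).BlockTriangular id := by
    rw [hb]; exact Matrix.blockTriangular_diagonal y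
  have key : ∀ i : Fin 3, WithZero.exp (-hd.iwasawaExp b i) = Valued.v (y i) := fun i => by
    rw [← hd.v_apply_self_eq_exp_neg_iwasawaExp htri i, hb, Matrix.diagonal_apply_eq]
  have e0 : hd.iwasawaExp b 0 = m := by
    have h := key 0; rw [h0] at h; have := WithZero.exp_injective h; omega
  have e1 : hd.iwasawaExp b 1 = 0 := by
    have h := key 1; rw [h1, ← WithZero.exp_zero] at h; have := WithZero.exp_injective h; omega
  have e2 : hd.iwasawaExp b 2 = -m := by
    have h := key 2; rw [h2] at h; have := WithZero.exp_injective h; omega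
  funext i
  fin_cases i
  · simpa using e0
  · simpa using e1
  · simp only [Fin.reduceFinMk, Nat.cast_ofNat, e2]; ring

/-- **`a(diag(y₀, y₁)) = ℓ²_m = (m, −m)`** for a diagonal element of `U(σ, J₀)(K)` (`N = 2`) with `v(y₀) = exp(−m)`, `v(y₁) = exp m`. [cite: BruhatTits1972, (4.4.3)]
[cite: CartierCorvallis1979, §IV (4.2)] -/
theorem iwasawaExp_eq_lineTwo_of_diagonal (hd : UnramifiedLocalConjDatum σ ϖ)
    {b : unitaryGroupOfForm σ ((StdForm.antidiagonal 2).over K)} {y : Fin 2 → K}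
    (hb : ((b : GL (Fin 2) K) : Matrix (Fin 2) (Fin 2) K) = Matrix.diagonal y) {m : ℤ}
    (h0 : Valued.v (y 0) = WithZero.exp (-m)) (h1 : Valued.v (y 1) = WithZero.exp m) :
    hd.iwasawaExp b = fun i : Fin 2 => m * (1 - 2 * ((i : ℕ) : ℤ)) := by
  have htri : ((b : GL (Fin 2) K) : Matrix (Fin 2) (Fin 2) K).BlockTriangular id := by
    rw [hb]; exact Matrix.blockTriangular_diagonal y
  have key : ∀ i : Fin 2, WithZero.exp (-hd.iwasawaExp b i) = Valued.v (y i) := fun i => by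
    rw [← hd.v_apply_self_eq_exp_neg_iwasawaExp htri i, hb, Matrix.diagonal_apply_eq]
  have e0 : hd.iwasawaExp b 0 = m := by
    have h := key 0; rw [h0] at h; have := WithZero.exp_injective h; omega
  have e1 : hd.iwasawaExp b 1 = -m := by
    have h := key 1; rw [h1] at h; have := WithZero.exp_injective h; omega
  funext i
  fin_cases i
  · simpa using e0
  · simp only [Fin.mk_one, Fin.isValue, Nat.cast_one, e1]; ring

end Diagonal

section Scalar

/-- `(ν K · J).toReal • X = J · X` for `ν K = 1` (the unit Haar normalisation of the socket applied to the ★ canonical-value constant; used through `Eq.trans`,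
so that no rewriting inside the instance-laden `J`-tokens is needed). [cite: Rogawski1990, §4.3 p. 43] -/
theorem toReal_measure_mul_coe_smul_eq {α : Type*} [MeasurableSpace α] {ν : Measure α} {K : Set α} (hν : ν K = 1) (J : ℝ≥0) (X : ℂ) :
    (ν K * (J : ℝ≥0∞)).toReal • X = ((J : ℝ) : ℂ) * X := by
  rw [hν, one_mul, ENNReal.coe_toReal, Complex.real_smul]

end Scalar

/-! ## §C The hyperbolic clause for the framed Hecke test functions `(T₂[K₀′] ∘ eH ∘ fst, T₃[K₀] ∘ eG)` -/

section Closed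

/-- **CARD F5 (B2d) CLOSED — THE HYPERBOLIC (LEVI-STRATUM) CLAUSE OF THE HECKE-ALGEBRA FUNDAMENTAL LEMMA AT `Δ‴_v` FOR FRAMED HECKE TEST FUNCTIONS.**
At a finite place `v` of `L⁺` non-split (`c • w = w`) and unramified in the CM field `L`, `H′` hermitian with invertible determinant of good reduction at `w`, `μ`
unramified at `w` under the μ-guard: in the frame of R90-C14-p01's (B2a) values — the stub frame `e = cmDatumLocalCongr L v T₀ ha₀ hT₀` of `G′_v = U(H′)(L⁺_v)`, CANONICAL
families `mG` (for `IsRegularElt`, Haar `νG`) and `mH` (for `IsLocalGRegular`, Haar `νH`), the hyperspecial levels `K = K₃ ≤ U(Φ₃)(L⁺_v)`, `K₂ ≤ U(Φ₂)(L⁺_v)` with finite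
Haar pieces `κ`, `μ_N`, `κ₂`, `μ_{N₂}`, local transports `eG : G′_v ≃ₜ* U(J₀,3)(L_w)`, `eH : U(Φ₂)(L⁺_v) ≃ₜ* U(J₀,2)(L_w)` whose composites with the frames carry the
N-LAWS and K-LAWS (binders `hN hEK EN hEN`, `hN₂ hEK₂ EN₂ hEN₂`), an unramified datum `hdw` at `w`, and Hecke operators `φ ∈ ℋ(U(J₀,3)(L_w), K₀)`, `φ^H ∈ ℋ(U(J₀,2)(L_w), K₀)`
in SATAKE-GRAPH position (`hgraph`: `λ^{(2)}_{(z,1)}(φ^H) = λ^{(3)}_{(−z,1,1)}(φ)` for all `z`, the socket's `SatakeGraph` unfolded) — for every `γ_H = (diag(d′₀, d′₁), u) ∈ H_v`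
on the Levi stratum, `G`-regular, with `ord_w d′₀ = m` (`hm`), under the unit normalisations `νG(e K₃) = 1` (`hνG1`), `νH(K_H) = 1` (`hνH1`) and the TORUS ENTRY LAWS of
the two composite frames (`hEt`, `hEHt`: the framed torus elements are the diagonal matrices of the `w`-components — the case for the one-place model ★ `localNonsplitEquiv`):
`Φ^st(γ_H, T₂[K₀] ∘ eH ∘ fst) = ∑ᶠ c, Δ‴_v(γ_H, out c) · Φ(c, T₃[K₀] ∘ eG)` — the clause of ★ `isLocalDeltaTransfer_iff` at `γ_H` for the socket's test functions
(`heckeToFun K₀ T g = (toVector K₀ T).coeff ↑g` by `rfl`).  PROOF = ★ FILE 1 HEAD `stableOrbitalIntegralRel_eq_finsum_finExplicitDelta_of_levi_of_values` at the norm pair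
`γ₀ = e(ι_v γ_H)` (★ `isLocalNormPair_cmDatumLocalCongr_endoEmbLocal`) with `hΦG` ≔ ★ (B2a) `classOrbitalIntegral_coeff_toVector_frame_eq`, `hΦH` ≔ ★ (B2a)
`classOrbitalIntegral_prod_coeff_toVector_frame_eq_two`, bridged by ★ `twistModule_cmLocal_eq` ∕ ★ `twistModule_cmLocal_two_eq` (`J ↦ ‖·‖`-currency), §B
(`a = ℓ³_m`, `ℓ²_m`), `hνG1`∕`hνH1`; and `hS` ≔ §A. [cite: Rogawski1990, §4.9 Prop. 4.9.1 (b), (4.9.2), Lemma 4.9.2 pp. 54–56; §4.3 (4.3.1) p. 43]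
[cite: CartierCorvallis1979, §IV (4.2) p. 146, Cor. 4.2] -/
theorem stableOrbitalIntegralRel_coeff_toVector_eq_finsum_finExplicitDelta_of_levi_of_frames
    (L : Type) [Field L] [NumberField L] [IsCMField L] (H' : Matrix (Fin 3) (Fin 3) L)
    (hH' : (H'.map (IsCMField.complexConj L))ᵀ = H') (hH'd : IsUnit H'.det)
    {v : HeightOneSpectrum (𝓞 ↥(maximalRealSubfield L))} (w : PlacesOver L v)
    (hw : IsCMField.complexConj L • w.1 = w.1) (hv : Algebra.IsUnramifiedIn (𝓞 L) v.asIdeal)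
    (hH'w : IsUnit (placeForm H' w.1)) (hH'i : hH'w.unit ∈ glInt 3 (w.1.adicCompletion L))
    (μ : HeckeCharacter L) (hμ : μ.IsUnramifiedAt w.1)
    (hμω : ∀ x : ideleGroup ↥(maximalRealSubfield L), μ (AdeleRing.ideleBaseChange ↥(maximalRealSubfield L) L x) = quadraticHeckeCharCM L x)
    [MeasurableSpace ((cmDatum L 3 H').Local v)] [BorelSpace ((cmDatum L 3 H').Local v)]
    [∀ γ : ((cmDatum L 3 H').Local v), MeasurableSpace (((cmDatum L 3 H').Local v) ⧸ Subgroup.centralizer ({γ} : Set ((cmDatum L 3 H').Local v)))]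
    [∀ γ : ((cmDatum L 3 H').Local v), BorelSpace (((cmDatum L 3 H').Local v) ⧸ Subgroup.centralizer ({γ} : Set ((cmDatum L 3 H').Local v)))]
    [MeasurableSpace ((cmDatum L 2 (Matrix.of fun i j : Fin 2 => if i.val + j.val + 1 = 2 then (1 : L) else 0)).Local v ×
      (cmDatum L 1 (Matrix.of fun i j : Fin 1 => if i.val + j.val + 1 = 1 then (1 : L) else 0)).Local v)]
    [BorelSpace ((cmDatum L 2 (Matrix.of fun i j : Fin 2 => if i.val + j.val + 1 = 2 then (1 : L) else 0)).Local v ×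
      (cmDatum L 1 (Matrix.of fun i j : Fin 1 => if i.val + j.val + 1 = 1 then (1 : L) else 0)).Local v)]
    [∀ a : ((cmDatum L 2 (Matrix.of fun i j : Fin 2 => if i.val + j.val + 1 = 2 then (1 : L) else 0)).Local v ×
      (cmDatum L 1 (Matrix.of fun i j : Fin 1 => if i.val + j.val + 1 = 1 then (1 : L) else 0)).Local v),
      MeasurableSpace (((cmDatum L 2 (Matrix.of fun i j : Fin 2 => if i.val + j.val + 1 = 2 then (1 : L) else 0)).Local v ×
      (cmDatum L 1 (Matrix.of fun i j : Fin 1 => if i.val + j.val + 1 = 1 then (1 : L) else 0)).Local v) ⧸ Subgroup.centralizer ({a} : Set ((cmDatum L 2 (Matrix.of fun i j : Fin 2 => if i.val + j.val + 1 = 2 then (1 : L) else 0)).Local v ×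
      (cmDatum L 1 (Matrix.of fun i j : Fin 1 => if i.val + j.val + 1 = 1 then (1 : L) else 0)).Local v)))]
    [∀ a : ((cmDatum L 2 (Matrix.of fun i j : Fin 2 => if i.val + j.val + 1 = 2 then (1 : L) else 0)).Local v ×
      (cmDatum L 1 (Matrix.of fun i j : Fin 1 => if i.val + j.val + 1 = 1 then (1 : L) else 0)).Local v),
      BorelSpace (((cmDatum L 2 (Matrix.of fun i j : Fin 2 => if i.val + j.val + 1 = 2 then (1 : L) else 0)).Local v ×
      (cmDatum L 1 (Matrix.of fun i j : Fin 1 => if i.val + j.val + 1 = 1 then (1 : L) else 0)).Local v) ⧸ Subgroup.centralizer ({a} : Set ((cmDatum L 2 (Matrix.of fun i j : Fin 2 => if i.val + j.val + 1 = 2 then (1 : L) else 0)).Local v ×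
      (cmDatum L 1 (Matrix.of fun i j : Fin 1 => if i.val + j.val + 1 = 1 then (1 : L) else 0)).Local v)))]
    (hl : ∀ (v : HeightOneSpectrum (𝓞 ↥(maximalRealSubfield L))) (a : ((cmDatum L 2 (Matrix.of fun i j : Fin 2 => if i.val + j.val + 1 = 2 then (1 : L) else 0)).Local v ×
      (cmDatum L 1 (Matrix.of fun i j : Fin 1 => if i.val + j.val + 1 = 1 then (1 : L) else 0)).Local v)) (b : (cmDatum L 3 H').Local v) (x : ((cmDatum L 2 (Matrix.of fun i j : Fin 2 => if i.val + j.val + 1 = 2 then (1 : L) else 0)).Local v ×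
      (cmDatum L 1 (Matrix.of fun i j : Fin 1 => if i.val + j.val + 1 = 1 then (1 : L) else 0)).Local v)),
      finExplicitDelta L v H' (x * a * x⁻¹) μ b = finExplicitDelta L v H' a μ b)
    (hr : ∀ (v : HeightOneSpectrum (𝓞 ↥(maximalRealSubfield L))) (a : ((cmDatum L 2 (Matrix.of fun i j : Fin 2 => if i.val + j.val + 1 = 2 then (1 : L) else 0)).Local v ×
      (cmDatum L 1 (Matrix.of fun i j : Fin 1 => if i.val + j.val + 1 = 1 then (1 : L) else 0)).Local v)) (b y : (cmDatum L 3 H').Local v),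
      finExplicitDelta L v H' a μ (y * b * y⁻¹) = finExplicitDelta L v H' a μ b)
    -- the two canonical families
    (νG : Measure ((cmDatum L 3 H').Local v)) [νG.IsHaarMeasure] [νG.IsMulRightInvariant]
    {mG : OrbitalMeasureFamily ((cmDatum L 3 H').Local v)}
    (hmG : mG.IsCanonical (fun γ => IsRegularElt (γ.val : GL (Fin 3) (UnitaryGroup.LocalRing L v))) νG)
    (νH : Measure ((cmDatum L 2 (Matrix.of fun i j : Fin 2 => if i.val + j.val + 1 = 2 then (1 : L) else 0)).Local v ×
      (cmDatum L 1 (Matrix.of fun i j : Fin 1 => if i.val + j.val + 1 = 1 then (1 : L) else 0)).Local v)) [νH.IsHaarMeasure] [νH.IsMulRightInvariant]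
    {mH : OrbitalMeasureFamily ((cmDatum L 2 (Matrix.of fun i j : Fin 2 => if i.val + j.val + 1 = 2 then (1 : L) else 0)).Local v ×
      (cmDatum L 1 (Matrix.of fun i j : Fin 1 => if i.val + j.val + 1 = 1 then (1 : L) else 0)).Local v)}
    (hmH : mH.IsCanonical (IsLocalGRegular L v) νH)
    -- the `G`-side frame of (B2a): the stub frame `e`, the level `K = K₃`, the Iwasawa measures
    (T₀ : GL (Fin 3) (UnitaryGroup.LocalRing L v)) {a₀ : UnitaryGroup.LocalRing L v} (ha₀ : IsUnit a₀)
    (hT₀ : formCongr (conjLocal L (IsCMField.complexConj L) v) T₀ (H'.map (algebraMap L (UnitaryGroup.LocalRing L v))) =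
      a₀ • (Matrix.of fun i j : Fin 3 => if i.val + j.val + 1 = 3 then (1 : L) else 0).map (algebraMap L (UnitaryGroup.LocalRing L v)))
    [MeasurableSpace ↥(unitaryGroupOfForm (conjLocal L (IsCMField.complexConj L) v) (cmLocalForm L 3 v))]
    [BorelSpace ↥(unitaryGroupOfForm (conjLocal L (IsCMField.complexConj L) v) (cmLocalForm L 3 v))]
    {K : Subgroup ↥(unitaryGroupOfForm (conjLocal L (IsCMField.complexConj L) v) (cmLocalForm L 3 v))}
    (hKv : ∀ g : ↥(unitaryGroupOfForm (conjLocal L (IsCMField.complexConj L) v) (cmLocalForm L 3 v)),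
      g ∈ K ↔ g ∈ cmLocalIntegralLevel L 3 (Matrix.of fun i j : Fin 3 => if i.val + j.val + 1 = 3 then (1 : L) else 0) v)
    (hKo : IsOpen (K : Set ↥(unitaryGroupOfForm (conjLocal L (IsCMField.complexConj L) v) (cmLocalForm L 3 v))))
    (κ : Measure ↥K) [κ.IsHaarMeasure] [SFinite κ] (hκ : κ Set.univ ≠ ∞)
    (μN : Measure ↥(unipotentU (conjLocal L (IsCMField.complexConj L) v) (cmLocalForm L 3 v))) [μN.IsHaarMeasure] [SFinite μN]
    (hμN : μN {n | (n : ↥(unitaryGroupOfForm (conjLocal L (IsCMField.complexConj L) v) (cmLocalForm L 3 v))) ∈ K} ≠ ∞)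
    -- the Hecke data at `w`: the socket's carriers, the unramified datum, the transports with their laws
    [MeasurableSpace ↥(unitaryGroupOfForm (galAdicCompletionMap (L := L) (IsCMField.complexConj L) hw) ((StdForm.antidiagonal 3).over (w.1.adicCompletion L)))]
    [BorelSpace ↥(unitaryGroupOfForm (galAdicCompletionMap (L := L) (IsCMField.complexConj L) hw) ((StdForm.antidiagonal 3).over (w.1.adicCompletion L)))]
    [Finite 𝓀[w.1.adicCompletion L]] {ϖ : w.1.adicCompletion L}
    (hdw : UnramifiedLocalConjDatum (galAdicCompletionMap (L := L) (IsCMField.complexConj L) hw) ϖ)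
    (eG : (cmDatum L 3 H').Local v ≃ₜ*
      ↥(unitaryGroupOfForm (galAdicCompletionMap (L := L) (IsCMField.complexConj L) hw) ((StdForm.antidiagonal 3).over (w.1.adicCompletion L))))
    (hN : ∀ g : ↥(unitaryGroupOfForm (conjLocal L (IsCMField.complexConj L) v) (cmLocalForm L 3 v)),
      g ∈ unipotentU (conjLocal L (IsCMField.complexConj L) v) (cmLocalForm L 3 v) ↔
        eG (cmDatumLocalCongr L v T₀ ha₀ hT₀ g) ∈
          unipotentU (galAdicCompletionMap (L := L) (IsCMField.complexConj L) hw) ((StdForm.antidiagonal 3).over (w.1.adicCompletion L)))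
    (hEK : ∀ g : ↥(unitaryGroupOfForm (conjLocal L (IsCMField.complexConj L) v) (cmLocalForm L 3 v)),
      eG (cmDatumLocalCongr L v T₀ ha₀ hT₀ g) ∈
          unitaryInt (galAdicCompletionMap (L := L) (IsCMField.complexConj L) hw) ((StdForm.antidiagonal 3).over (w.1.adicCompletion L)) ↔ g ∈ K)
    (EN : ↥(unipotentU (conjLocal L (IsCMField.complexConj L) v) (cmLocalForm L 3 v)) ≃ₜ*
      ↥(unipotentU (galAdicCompletionMap (L := L) (IsCMField.complexConj L) hw) ((StdForm.antidiagonal 3).over (w.1.adicCompletion L))))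
    (hEN : ∀ n : ↥(unipotentU (conjLocal L (IsCMField.complexConj L) v) (cmLocalForm L 3 v)),
      ((EN n : ↥(unipotentU (galAdicCompletionMap (L := L) (IsCMField.complexConj L) hw) ((StdForm.antidiagonal 3).over (w.1.adicCompletion L)))) :
          ↥(unitaryGroupOfForm (galAdicCompletionMap (L := L) (IsCMField.complexConj L) hw) ((StdForm.antidiagonal 3).over (w.1.adicCompletion L)))) =
        eG (cmDatumLocalCongr L v T₀ ha₀ hT₀ (n : ↥(unitaryGroupOfForm (conjLocal L (IsCMField.complexConj L) v) (cmLocalForm L 3 v)))))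
    (φ : heckeAlgebra ℂ ↥(unitaryGroupOfForm (galAdicCompletionMap (L := L) (IsCMField.complexConj L) hw) ((StdForm.antidiagonal 3).over (w.1.adicCompletion L)))
      (unitaryInt (galAdicCompletionMap (L := L) (IsCMField.complexConj L) hw) ((StdForm.antidiagonal 3).over (w.1.adicCompletion L))))
    -- the `H`-side frame of (B2a) FILE 3: the level `K₂`, the Iwasawa measures, the transport `eH` with its laws
    [MeasurableSpace ↥(unitaryGroupOfForm (conjLocal L (IsCMField.complexConj L) v) (cmLocalForm L 2 v))]
    [BorelSpace ↥(unitaryGroupOfForm (conjLocal L (IsCMField.complexConj L) v) (cmLocalForm L 2 v))]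
    (K₂ : Subgroup ↥(unitaryGroupOfForm (conjLocal L (IsCMField.complexConj L) v) (cmLocalForm L 2 v)))
    (hK2 : K₂ = cmLocalIntegralLevel L 2 (Matrix.of fun i j : Fin 2 => if i.val + j.val + 1 = 2 then (1 : L) else 0) v)
    (hKo₂ : IsOpen (K₂ : Set ↥(unitaryGroupOfForm (conjLocal L (IsCMField.complexConj L) v) (cmLocalForm L 2 v))))
    (κ₂ : Measure ↥K₂) [κ₂.IsHaarMeasure] [SFinite κ₂] (hκ₂ : κ₂ Set.univ ≠ ∞)
    (μN₂ : Measure ↥(cmBorelTriple L 2 v).N) [μN₂.IsHaarMeasure] [SFinite μN₂]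
    (hμ₂ : μN₂ {n | (n : ↥(unitaryGroupOfForm (conjLocal L (IsCMField.complexConj L) v) (cmLocalForm L 2 v))) ∈ K₂} ≠ ∞)
    [MeasurableSpace ↥(unitaryGroupOfForm (galAdicCompletionMap (L := L) (IsCMField.complexConj L) hw) ((StdForm.antidiagonal 2).over (w.1.adicCompletion L)))]
    [BorelSpace ↥(unitaryGroupOfForm (galAdicCompletionMap (L := L) (IsCMField.complexConj L) hw) ((StdForm.antidiagonal 2).over (w.1.adicCompletion L)))]
    (eH : (cmDatum L 2 (Matrix.of fun i j : Fin 2 => if i.val + j.val + 1 = 2 then (1 : L) else 0)).Local v ≃ₜ*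
      ↥(unitaryGroupOfForm (galAdicCompletionMap (L := L) (IsCMField.complexConj L) hw) ((StdForm.antidiagonal 2).over (w.1.adicCompletion L))))
    (hN₂ : ∀ g : ↥(unitaryGroupOfForm (conjLocal L (IsCMField.complexConj L) v) (cmLocalForm L 2 v)), g ∈ (cmBorelTriple L 2 v).N ↔
      eH g ∈ unipotentU (galAdicCompletionMap (L := L) (IsCMField.complexConj L) hw) ((StdForm.antidiagonal 2).over (w.1.adicCompletion L)))
    (hEK₂ : ∀ g : ↥(unitaryGroupOfForm (conjLocal L (IsCMField.complexConj L) v) (cmLocalForm L 2 v)),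
      eH g ∈ unitaryInt (galAdicCompletionMap (L := L) (IsCMField.complexConj L) hw) ((StdForm.antidiagonal 2).over (w.1.adicCompletion L)) ↔ g ∈ K₂)
    (EN₂ : ↥(cmBorelTriple L 2 v).N ≃ₜ* ↥(unipotentU (galAdicCompletionMap (L := L) (IsCMField.complexConj L) hw) ((StdForm.antidiagonal 2).over (w.1.adicCompletion L))))
    (hEN₂ : ∀ n : ↥(cmBorelTriple L 2 v).N, ((EN₂ n : ↥(unipotentU (galAdicCompletionMap (L := L) (IsCMField.complexConj L) hw) ((StdForm.antidiagonal 2).over (w.1.adicCompletion L)))) :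
        ↥(unitaryGroupOfForm (galAdicCompletionMap (L := L) (IsCMField.complexConj L) hw) ((StdForm.antidiagonal 2).over (w.1.adicCompletion L)))) =
      eH (n : ↥(unitaryGroupOfForm (conjLocal L (IsCMField.complexConj L) v) (cmLocalForm L 2 v))))
    (φH : heckeAlgebra ℂ ↥(unitaryGroupOfForm (galAdicCompletionMap (L := L) (IsCMField.complexConj L) hw) ((StdForm.antidiagonal 2).over (w.1.adicCompletion L)))
      (unitaryInt (galAdicCompletionMap (L := L) (IsCMField.complexConj L) hw) ((StdForm.antidiagonal 2).over (w.1.adicCompletion L))))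
    -- the Satake-graph relation (the socket's `SatakeGraph L v w hw hv φ φH`, unfolded)
    (hgraph : ∀ z : ℂˣ,
      unitaryHeckeEigencharacterAdic (IsCMField.complexConj L) (IsCMField.complexConj_ne_one L) v w hw hv ![z, 1] φH =
        unitaryHeckeEigencharacterAdic (IsCMField.complexConj L) (IsCMField.complexConj_ne_one L) v w hw hv ![-z, 1, 1] φ)
    -- `γ_H` on the Levi stratum, `G`-regular, `ord_w d′₀ = m`
    {γH : ((cmDatum L 2 (Matrix.of fun i j : Fin 2 => if i.val + j.val + 1 = 2 then (1 : L) else 0)).Local v ×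
      (cmDatum L 1 (Matrix.of fun i j : Fin 1 => if i.val + j.val + 1 = 1 then (1 : L) else 0)).Local v)}
    {d' : Fin 2 → (UnitaryGroup.LocalRing L v)ˣ} (hd' : glDiagonal 2 (UnitaryGroup.LocalRing L v) d' = (γH.1.val : GL (Fin 2) (UnitaryGroup.LocalRing L v)))
    (hreg : IsLocalGRegular L v γH)
    (ha : IsUnit ((((d' 0)⁻¹ * (isUnit_finGammaTwo L v γH).unit : (UnitaryGroup.LocalRing L v)ˣ) : UnitaryGroup.LocalRing L v) - 1))
    (hb : IsUnit ((((d' 0)⁻¹ * d' 1 : (UnitaryGroup.LocalRing L v)ˣ) : UnitaryGroup.LocalRing L v) - 1))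
    (h12 : IsUnit (finGammaTwo L v γH - (d' 1 : UnitaryGroup.LocalRing L v)))
    {m : ℤ} (hm : Valued.v ((d' 0 : UnitaryGroup.LocalRing L v) w) = WithZero.exp (-m))
    -- the unit normalisations and the torus entry laws of the two composite frames
    (hνG1 : νG ((cmDatumLocalCongr L v T₀ ha₀ hT₀).symm ⁻¹' (K : Set ↥(unitaryGroupOfForm (conjLocal L (IsCMField.complexConj L) v) (cmLocalForm L 3 v)))) = 1)
    (hνH1 : νH ((((cmLocalIntegralLevel L 2 (Matrix.of fun i j : Fin 2 => if i.val + j.val + 1 = 2 then (1 : L) else 0) v).prod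
      (cmLocalIntegralLevel L 1 (Matrix.of fun i j : Fin 1 => if i.val + j.val + 1 = 1 then (1 : L) else 0) v)) :
        Subgroup ((cmDatum L 2 (Matrix.of fun i j : Fin 2 => if i.val + j.val + 1 = 2 then (1 : L) else 0)).Local v ×
          (cmDatum L 1 (Matrix.of fun i j : Fin 1 => if i.val + j.val + 1 = 1 then (1 : L) else 0)).Local v)) :
        Set ((cmDatum L 2 (Matrix.of fun i j : Fin 2 => if i.val + j.val + 1 = 2 then (1 : L) else 0)).Local v ×
          (cmDatum L 1 (Matrix.of fun i j : Fin 1 => if i.val + j.val + 1 = 1 then (1 : L) else 0)).Local v)) = 1)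
    (hEt : (((eG (cmDatumLocalCongr L v T₀ ha₀ hT₀ (endoEmbLocal L v γH)) :
        ↥(unitaryGroupOfForm (galAdicCompletionMap (L := L) (IsCMField.complexConj L) hw) ((StdForm.antidiagonal 3).over (w.1.adicCompletion L)))) :
          GL (Fin 3) (w.1.adicCompletion L)) : Matrix (Fin 3) (Fin 3) (w.1.adicCompletion L)) =
      Matrix.diagonal ![(d' 0 : UnitaryGroup.LocalRing L v) w, finGammaTwo L v γH w, (d' 1 : UnitaryGroup.LocalRing L v) w])
    (hEHt : (((eH γH.1 :
        ↥(unitaryGroupOfForm (galAdicCompletionMap (L := L) (IsCMField.complexConj L) hw) ((StdForm.antidiagonal 2).over (w.1.adicCompletion L)))) :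
          GL (Fin 2) (w.1.adicCompletion L)) : Matrix (Fin 2) (Fin 2) (w.1.adicCompletion L)) =
      Matrix.diagonal ![(d' 0 : UnitaryGroup.LocalRing L v) w, (d' 1 : UnitaryGroup.LocalRing L v) w]) :
    stableOrbitalIntegralRel (IsLocalStablyConjH L v) mH
        (fun h : ((cmDatum L 2 (Matrix.of fun i j : Fin 2 => if i.val + j.val + 1 = 2 then (1 : L) else 0)).Local v ×
            (cmDatum L 1 (Matrix.of fun i j : Fin 1 => if i.val + j.val + 1 = 1 then (1 : L) else 0)).Local v) =>
          (heckeAlgebra.toVector (unitaryInt (galAdicCompletionMap (L := L) (IsCMField.complexConj L) hw) ((StdForm.antidiagonal 2).over (w.1.adicCompletion L))) φH).coeff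
            ((eH h.1 : ↥(unitaryGroupOfForm (galAdicCompletionMap (L := L) (IsCMField.complexConj L) hw) ((StdForm.antidiagonal 2).over (w.1.adicCompletion L)))) :
              ↥(unitaryGroupOfForm (galAdicCompletionMap (L := L) (IsCMField.complexConj L) hw) ((StdForm.antidiagonal 2).over (w.1.adicCompletion L))) ⧸
                unitaryInt (galAdicCompletionMap (L := L) (IsCMField.complexConj L) hw) ((StdForm.antidiagonal 2).over (w.1.adicCompletion L))))
        γH =
      ∑ᶠ c : ConjClasses ((cmDatum L 3 H').Local v), (finExplicitCollection L H' μ hl hr v).Δ γH (Quotient.out c) *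
        classOrbitalIntegral mG
          (fun g : (cmDatum L 3 H').Local v =>
            (heckeAlgebra.toVector (unitaryInt (galAdicCompletionMap (L := L) (IsCMField.complexConj L) hw) ((StdForm.antidiagonal 3).over (w.1.adicCompletion L))) φ).coeff
              ((eG g : ↥(unitaryGroupOfForm (galAdicCompletionMap (L := L) (IsCMField.complexConj L) hw) ((StdForm.antidiagonal 3).over (w.1.adicCompletion L)))) :
                ↥(unitaryGroupOfForm (galAdicCompletionMap (L := L) (IsCMField.complexConj L) hw) ((StdForm.antidiagonal 3).over (w.1.adicCompletion L))) ⧸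
                  unitaryInt (galAdicCompletionMap (L := L) (IsCMField.complexConj L) hw) ((StdForm.antidiagonal 3).over (w.1.adicCompletion L)))) c := by
  haveI : Algebra.IsQuadraticExtension ↥(maximalRealSubfield L) L := IsCMField.isQuadraticExtension L
  -- the Levi-stratum data of `γ_H` in `U(Φ₃)`-coordinates
  have hι := endoEmbLocal_eq_glDiagonal_of_fst_eq L v γH hd'
  have hu : (((isUnit_finGammaTwo L v γH).unit : (UnitaryGroup.LocalRing L v)ˣ) : UnitaryGroup.LocalRing L v) = finGammaTwo L v γH :=
    (isUnit_finGammaTwo L v γH).unit_spec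
  have hreg3 := isUnit_vecCons_sub_of_levi ha hb (by rw [hu]; exact h12)
  have ht := endoEmbLocal_mem_torusU_of_endoEmbLocal_eq L v γH hι
  have ht₂ : γH.1 ∈ torusU (conjLocal L (IsCMField.complexConj L) v) (cmLocalForm L 2 v) := ⟨d', hd'⟩
  -- valuations at the one place `w`: `v(u_w) = 1`, `v(d′₁,w) = exp m`
  have hvu : Valued.v (finGammaTwo L v γH w) = 1 := valued_finGammaTwo_apply_eq_one L v γH w hw
  have hv₁ : Valued.v ((d' 1 : UnitaryGroup.LocalRing L v) w) = WithZero.exp m := by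
    obtain ⟨-, -, h02⟩ := HeisRing.torus_relations (conjLocal L (IsCMField.complexConj L) v) (cmLocalForm_eq_over L 3 v) ⟨_, ht⟩ hι.symm
    simp only [Matrix.cons_val_zero, Matrix.cons_val_two, Matrix.tail_cons, Matrix.head_cons] at h02
    have h := congrFun h02 w
    rw [Pi.mul_apply, Pi.one_apply, conjLocal_apply_eq_galAdicCompletionMap L v w hw] at h
    have hval := congrArg (fun z => Valued.v z) h
    simp only [map_mul, map_one, valued_galAdicCompletionMap, hm] at hval
    calc Valued.v ((d' 1 : UnitaryGroup.LocalRing L v) w)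
        = WithZero.exp m * (WithZero.exp (-m) * Valued.v ((d' 1 : UnitaryGroup.LocalRing L v) w)) := by
          rw [← mul_assoc, ← WithZero.exp_add, add_neg_cancel, WithZero.exp_zero, one_mul]
      _ = WithZero.exp m := by rw [hval, mul_one]
  -- the norm pair `γ₀ = e(ι_v γ_H)`
  have h₀ := isLocalNormPair_cmDatumLocalCongr_endoEmbLocal L H' T₀ ha₀ hT₀ γH
  -- the `G`-SIDE VALUE (★ (B2a) FILE 2) in `‖·‖`-currency at `a = ℓ³_m`
  have hG := classOrbitalIntegral_coeff_toVector_frame_eq L H' hH' hH'd w hw T₀ ha₀ hT₀ νG hmG hKv hKo κ hκ μN hμN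
    ⟨endoEmbLocal L v γH, ht⟩ hι.symm hreg3 ha hb hdw eG hN hEK EN hEN φ
  have hιG : hdw.iwasawaExp (eG (cmDatumLocalCongr L v T₀ ha₀ hT₀ (endoEmbLocal L v γH))) = fun i : Fin 3 => m * (1 - ((i : ℕ) : ℤ)) :=
    iwasawaExp_eq_lineThree_of_diagonal hdw hEt hm hvu hv₁
  have hJG := twistModule_cmLocal_eq L v ht hι.symm ha hb
  -- (the scalar dress goes through `Eq.trans` ∕ `congrArg`: a keyed `rw` inside the instance-laden value tokens does not terminate)
  have hGval := ((hG.trans (toReal_measure_mul_coe_smul_eq hνG1 _ _)).trans (congrArg (fun r : ℝ≥0 => ((r : ℝ) : ℂ) * _) hJG)).trans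
    (congrArg (fun a : Fin 3 → ℤ => ((((unitModulusChar (UnitaryGroup.LocalRing L v) ha.unit *
        NNReal.sqrt (unitModulusChar (UnitaryGroup.LocalRing L v) hb.unit))⁻¹ : ℝ≥0) : ℝ) : ℂ) *
      ((satakeWeight (residueCardSqrt (w.1.adicCompletion L)) a)⁻¹ * (hdw.satakeTransform φ).coeff a)) hιG)
  -- the `H`-SIDE VALUE (★ (B2a) FILE 3) in `‖·‖`-currency at `a = ℓ²_m`
  have h01 : IsUnit ((d' 0 : UnitaryGroup.LocalRing L v) - d' 1) := by simpa using hreg3 0 2 (by decide)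
  have hreg₂ : IsRegularElt (γH.1.val : GL (Fin 2) (UnitaryGroup.LocalRing L v)) := by
    letI : Field (UnitaryGroup.LocalRing L v) :=
      (UnitaryGroup.LocalRing.isField_of_smul_eq (IsCMField.complexConj L) (IsCMField.complexConj_ne_one L) w hw).toField
    rw [isRegularElt_iff, ← hd', coe_glDiagonal, Matrix.charpoly_diagonal]
    refine Polynomial.separable_prod_X_sub_C_iff.2 fun i j hij => ?_
    by_contra hne
    have hu' : IsUnit ((d' i : UnitaryGroup.LocalRing L v) - d' j) := by
      fin_cases i <;> fin_cases j
      · exact absurd rfl hne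
      · exact h01
      · simpa using h01.neg
      · exact absurd rfl hne
    rw [hij, sub_self] at hu'
    exact not_isUnit_zero hu'
  have hK₁ : ∀ x : (cmDatum L 1 (Matrix.of fun i j : Fin 1 => if i.val + j.val + 1 = 1 then (1 : L) else 0)).Local v,
      x ∈ cmLocalIntegralLevel L 1 (Matrix.of fun i j : Fin 1 => if i.val + j.val + 1 = 1 then (1 : L) else 0) v := fun x => by
    rw [cmLocalIntegralLevel_one_eq_top_of_smul_eq L _ w hw (isUnit_placeForm_antidiagOne (E := L) 1 w.1)]; exact Subgroup.mem_top x
  have hH := classOrbitalIntegral_prod_coeff_toVector_frame_eq_two L w hw νH hmH K₂ hK2 hKo₂ κ₂ hκ₂ μN₂ hμ₂ ⟨γH.1, ht₂⟩ hd' hb hreg₂ γH.2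
    (isLocalGRegular_out_mk hreg) hK₁ hdw eH hN₂ hEK₂ EN₂ hEN₂ φH
  have hιH : hdw.iwasawaExp (eH γH.1) = fun i : Fin 2 => m * (1 - 2 * ((i : ℕ) : ℤ)) :=
    iwasawaExp_eq_lineTwo_of_diagonal hdw hEHt hm hv₁
  have hJH := twistModule_cmLocal_two_eq L v ht₂ hd' hb
  have hHval := ((hH.trans (toReal_measure_mul_coe_smul_eq hνH1 _ _)).trans (congrArg (fun r : ℝ≥0 => ((r : ℝ) : ℂ) * _) hJH)).trans
    (congrArg (fun a : Fin 2 → ℤ => ((((NNReal.sqrt (unitModulusChar (UnitaryGroup.LocalRing L v) hb.unit))⁻¹ : ℝ≥0) : ℝ) : ℂ) *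
      ((satakeWeight (residueCardSqrt (w.1.adicCompletion L)) a)⁻¹ * (hdw.satakeTransform φH).coeff a)) hιH)
  -- the sign transport for the Satake-graph pair
  have hS := coeff_satakeTransform_of_satakeGraph (IsCMField.complexConj L) (IsCMField.complexConj_ne_one L) v w hw hv hdw φ φH hgraph m
  -- assemble
  exact stableOrbitalIntegralRel_eq_finsum_finExplicitDelta_of_levi_of_values L H' hH' hH'd w hw hv hH'w hH'i μ hμ hμω hl hr mH mG _ _ hd' ha hb h12 hm h₀
    hS hHval hGval

end Closed

end Summit.HodgeConjecture.HodgeConjecture.R90.S6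

end
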